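import Literature.IUT.LogVolume.Corollary22Statement
import Mathlib.FieldTheory.Normal.Basic
import Mathlib.FieldTheory.Galois.Basic
import Mathlib.FieldTheory.Perfect
import HarnessLib

/-!
# The `λ`-line over the `j`-line: `F_tpd = ℚ(λ)` is Galois over `F_mod = ℚ(j(λ))` (the anharmonic group)

Mochizuki, *Inter-universal Teichmüller theory IV*, RIMS manuscript (Apr. 2020; = PRIMS **57** (2021)),
Thm. 1.10 p. 22 / Cor. 2.2 (ii) p. 42: "`F_mod ⊆ F_tpd := F_mod(E_{F_mod}[2]) ⊆ F` … the “tripodal” intermediate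
field obtained from `F_mod` by adjoining the fields of definition of the 2-torsion points" — so `F_tpd/F_mod` is
GALOIS (a splitting field); Step (iii) of the proof of Thm. 1.10 (p. 26, "by considering the various
possibilities for elements `∈ Supp(𝔰^{F_mod}_ADiv)`") uses that the places of `F_tpd` over one place of `F_mod`
all have the same ramification. In the tree's model of the `λ`-line (`Corollary22Statement.lean`,
`Corollary22Legendre.lean`: a point is `λ` presented over its minimal field `F_tpd = ℚ(λ)`, and
`F_mod = ℚ(j(λ))`, `j(λ) = 2^8(λ²−λ+1)³/(λ²(λ−1)²)`) this is the classical fact PROVED here: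

* `anharmonicPoly j := 256·(X²−X+1)³ − j·X²(X−1)²` — the fibre of the `j`-map `λ ↦ j(λ)` (Silverman, AEC
  III.1.7); `anharmonicPoly_jInv_eq_prod`: for `λ ≠ 0, 1` it factors over `ℚ(λ)` as `256·∏(X − σ(λ))` over the
  six anharmonic values `σ(λ) ∈ {λ, 1−λ, 1/λ, 1/(1−λ), λ/(λ−1), (λ−1)/λ}`; hence it splits in `ℚ(λ)`;
* `isSplittingField_anharmonicPoly`, `normal_adjoin_jInv`, **`isGalois_adjoin_jInv`**: for `P ∈ UP`
  (`λ ≠ 0, 1`, `ℚ(λ) = P.F`), `P.F` is a splitting field of `anharmonicPoly j(λ)` over `ℚ(j(λ))`, hence normal,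
  hence (characteristic `0`) Galois over `ℚ(j(λ)) = IntermediateField.adjoin ℚ {jInv P.x}`.

Classical (anharmonic ratios); TAKES NO SIDE on anything disputed.
-/

noncomputable section

namespace Literature.IUT.LogVolume

namespace Cor22

open Polynomial IntermediateField Literature.NumberTheory.DiophantineGeometry.GenEll

/-- The fibre polynomial of the `j`-map on the `λ`-line: `256·(X²−X+1)³ − j·X²(X−1)²` (roots = the `λ` with
`j(λ) = j`). [cite: Mochizuki2012, IUTchIV Cor. 2.2 p.41] -/
def anharmonicPoly {K : Type*} [CommRing K] (j : K) : K[X] :=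
  C 256 * (X ^ 2 - X + 1) ^ 3 - C j * (X ^ 2 * (X - 1) ^ 2)

/-- Evaluation of the fibre polynomial. [cite: Mochizuki2012, IUTchIV Cor. 2.2 p.41] -/
theorem eval_anharmonicPoly {K : Type*} [CommRing K] (j x : K) :
    (anharmonicPoly j).eval x = 256 * (x ^ 2 - x + 1) ^ 3 - j * (x ^ 2 * (x - 1) ^ 2) := by
  simp [anharmonicPoly]

/-- The fibre polynomial maps along ring maps. [cite: Mochizuki2012, IUTchIV Cor. 2.2 p.41] -/
theorem map_anharmonicPoly {K L : Type*} [CommRing K] [CommRing L] (f : K →+* L) (j : K) :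
    (anharmonicPoly j).map f = anharmonicPoly (f j) := by
  simp [anharmonicPoly, Polynomial.map_sub, Polynomial.map_mul, Polynomial.map_pow, map_ofNat]

/-- The fibre polynomial is nonzero (its constant coefficient is `256`).
[cite: Mochizuki2012, IUTchIV Cor. 2.2 p.41] -/
theorem anharmonicPoly_ne_zero {K : Type*} [CommRing K] [CharZero K] (j : K) : anharmonicPoly j ≠ 0 := by
  intro h
  have := congrArg (fun p : K[X] => p.eval 0) h
  simp [anharmonicPoly] at this

/-- `λ` is a root of the fibre polynomial of `j(λ)` (`λ ≠ 0, 1`). [cite: Mochizuki2012, IUTchIV Cor. 2.2 p.41] -/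
theorem eval_anharmonicPoly_jInv_self {F : Type*} [Field F] {t : F} (h0 : t ≠ 0) (h1 : t ≠ 1) :
    (anharmonicPoly (jInv t)).eval t = 0 := by
  rw [eval_anharmonicPoly]
  have h1' : t - 1 ≠ 0 := sub_ne_zero.mpr h1
  unfold jInv
  field_simp
  ring

/-- **The anharmonic factorization**: for `λ ≠ 0, 1`,
`256·(X²−X+1)³ − j(λ)·X²(X−1)² = 256·∏_{σ} (X − σ(λ))` over the six anharmonic values
`λ, 1−λ, 1/λ, 1/(1−λ), λ/(λ−1), (λ−1)/λ`. [cite: Mochizuki2012, IUTchIV Cor. 2.2 p.41] -/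
theorem anharmonicPoly_jInv_eq_prod {F : Type*} [Field F] [CharZero F] {t : F} (h0 : t ≠ 0) (h1 : t ≠ 1) :
    anharmonicPoly (jInv t) = C 256 * ((X - C t) * (X - C (1 - t)) * (X - C t⁻¹) * (X - C (1 - t)⁻¹) *
      (X - C (t / (t - 1))) * (X - C ((t - 1) / t))) := by
  have h1' : t - 1 ≠ 0 := sub_ne_zero.mpr h1
  have h1'' : 1 - t ≠ 0 := sub_ne_zero.mpr (Ne.symm h1)
  apply Polynomial.funext
  intro x
  rw [eval_anharmonicPoly]
  simp only [eval_mul, eval_C, eval_sub, eval_X]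
  unfold jInv
  field_simp
  ring

/-- The fibre polynomial of `j(λ)` splits over `ℚ(λ)` (indeed over any field containing `λ ≠ 0, 1`).
[cite: Mochizuki2012, IUTchIV Cor. 2.2 p.41] -/
theorem splits_anharmonicPoly_jInv {F : Type*} [Field F] [CharZero F] {t : F} (h0 : t ≠ 0) (h1 : t ≠ 1) :
    (anharmonicPoly (jInv t)).Splits := by
  rw [anharmonicPoly_jInv_eq_prod h0 h1]
  refine Splits.C_mul ?_ 256
  refine ((((Splits.X_sub_C _).mul (Splits.X_sub_C _)).mul (Splits.X_sub_C _)).mul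
    (Splits.X_sub_C _)).mul (Splits.X_sub_C _) |>.mul (Splits.X_sub_C _)

/-! ## `ℚ(λ)` is Galois over `ℚ(j(λ))` -/

/-- `j(λ)` as an element of `F_mod = ℚ(j(λ)) ⊆ F_tpd`. [cite: Mochizuki2012, IUTchIV Cor. 2.2 p.42] -/
def jMod (P : NFPoint) : IntermediateField.adjoin ℚ ({jInv P.x} : Set P.F) :=
  ⟨jInv P.x, IntermediateField.mem_adjoin_simple_self ℚ (jInv P.x)⟩

/-- `F_tpd = ℚ(λ)` is a splitting field over `F_mod = ℚ(j(λ))` of the fibre polynomial of `j(λ)`, for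
`λ ∈ U_X` presented over its minimal field. [cite: Mochizuki2012, IUTchIV Cor. 2.2 p.42] -/
theorem isSplittingField_anharmonicPoly (P : NFPoint) (hP : P ∈ UP) :
    Polynomial.IsSplittingField (IntermediateField.adjoin ℚ ({jInv P.x} : Set P.F)) P.F
      (anharmonicPoly (jMod P)) := by
  set J := IntermediateField.adjoin ℚ ({jInv P.x} : Set P.F) with hJ
  have h0 : P.x ≠ 0 := hP.1.1
  have h1 : P.x ≠ 1 := hP.1.2
  have hmap : (anharmonicPoly (jMod P)).map (algebraMap J P.F) = anharmonicPoly (jInv P.x) := by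
    rw [map_anharmonicPoly]; rfl
  refine ⟨by rw [hmap]; exact splits_anharmonicPoly_jInv h0 h1, ?_⟩
  -- the roots generate: `λ` is a root and generates `P.F` over `ℚ`, a fortiori over `ℚ(j(λ))`
  rw [eq_top_iff]
  have hroot : P.x ∈ (anharmonicPoly (jMod P)).rootSet P.F := by
    rw [Polynomial.mem_rootSet_of_ne (anharmonicPoly_ne_zero _), ← Polynomial.eval_map_algebraMap, hmap]
    exact eval_anharmonicPoly_jInv_self h0 h1
  have hx : P.x ∈ Algebra.adjoin J ((anharmonicPoly (jMod P)).rootSet P.F) := Algebra.subset_adjoin hroot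
  -- `Algebra.adjoin ℚ {λ} = ⊤` (λ algebraic and `ℚ⟮λ⟯ = ⊤`), and it sits inside the `J`-adjoin
  have hint : IsIntegral ℚ P.x := Algebra.IsIntegral.isIntegral P.x
  have htop : Algebra.adjoin ℚ ({P.x} : Set P.F) = ⊤ := by
    have h := hP.2
    unfold NFPoint.IsMinimal at h
    rw [← IntermediateField.adjoin_simple_toSubalgebra_of_isAlgebraic hint.isAlgebraic, h]
    rfl
  intro y _
  have hy : y ∈ Algebra.adjoin ℚ ({P.x} : Set P.F) := by rw [htop]; exact Algebra.mem_top
  have hle : Algebra.adjoin ℚ ({P.x} : Set P.F) ≤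
      (Algebra.adjoin J ((anharmonicPoly (jMod P)).rootSet P.F)).restrictScalars ℚ :=
    Algebra.adjoin_le (Set.singleton_subset_iff.mpr hx)
  exact hle hy

/-- `F_tpd = ℚ(λ)` is normal over `F_mod = ℚ(j(λ))`. [cite: Mochizuki2012, IUTchIV Cor. 2.2 p.42] -/
theorem normal_adjoin_jInv (P : NFPoint) (hP : P ∈ UP) :
    Normal (IntermediateField.adjoin ℚ ({jInv P.x} : Set P.F)) P.F :=
  haveI := isSplittingField_anharmonicPoly P hP
  Normal.of_isSplittingField (anharmonicPoly (jMod P))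

/-- **`F_tpd = ℚ(λ)` is Galois over `F_mod = ℚ(j(λ))`** (characteristic `0`: normal ⟹ Galois) — the tree's
form of "`F_tpd := F_mod(E_{F_mod}[2])` is Galois over `F_mod`" ([IUTchIV] Thm. 1.10 p. 22, used in Step (iii)
p. 26). [cite: Mochizuki2012, IUTchIV Thm 1.10 p.22] -/
theorem isGalois_adjoin_jInv (P : NFPoint) (hP : P ∈ UP) :
    IsGalois (IntermediateField.adjoin ℚ ({jInv P.x} : Set P.F)) P.F :=
  haveI := normal_adjoin_jInv P hP
  IsGalois.mk

end Cor22

end Literature.IUT.LogVolume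

end
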